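import Summits.AnomalousDissipation.AnomalousDissipation.Theorems.SolenoidalFractalHomogenisationLagrangianStepSidebandResponseUniqueFrame
import Summits.AnomalousDissipation.AnomalousDissipation.Theorems.SolenoidalFractalHomogenisationLagrangianStepSidebandLinear
import HarnessLib

/-!
# K1L_D `LagrangianRenormalisationStepDesign` (stmt-AnomalousDissipation-27980), registered stub `stub_D1_V0thg` (v28, ruling D28-3 (3)), port-map layer L4:
# the FROZEN-FRAME periodic response and feedback matrices `M^θ_{jj'}` are `ℂ`-LINEAR (helper; `--supports stmt-AnomalousDissipation-27980 --as helper`)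

Summits-side helper file of route `SolenoidalFractalHomogenisation` (prover seat `ad-k1l-cellLawV-w1` g9; port map
`Cruxes/LagrangianRenormalisationStepDesign/Lines/onelevel-vtheta-twist-portmap.md` §3 L4, ruling D28-7).  The frozen-frame twin of `…SidebandLinear`
(`continuous_feedback` is flat and REUSED BY NAME).  Everything proved; no definitions, no named facts, no sorry.
* `isPeriodicResponseθ_smul_conj` — the rescaled twisted response `v ↦ a⁻¹ • N t (a • v)` is again a twisted periodic response (`a ≠ 0`; `sourceθ`, `genθ` are `ℂ`-linear);
* **`responseθ_map_smul`** — `responseθ … t (a • v) = a • responseθ … t v` on `[0,P]` (by UNIQUENESS `isPeriodicResponseθ_unique`, under `NearIso 𝔸 lo' hi'`,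
  `lo' > 0`, `γ₁ > 0` and the frame hypothesis `c|k|² ≤ |G₀ᵀk|²`, `c > 0`);
* **`meanFeedbackθ_map_smul`** — `M^θ_{jj'} (a • v) = a • M^θ_{jj'} v`.
At `G₀ = 1` these are literally `response_map_smul` / `meanFeedback_map_smul` (`responseθ_one`, `meanFeedbackθ_one`).
NOT a proof of any registered stub, of the crux, or of anomalous dissipation; rung F-D1 infrastructure for the `stub_D1_V0thg` engine.
-/

set_option linter.dupNamespace false

noncomputable section

namespace Summit.AnomalousDissipation.AnomalousDissipation.Theorems.SolenoidalFractalHomogenisation.LagrangianStep.Sideband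

open Set MeasureTheory Complex UnitAddTorus Filter Topology
open scoped InnerProductSpace
open Literature.Analysis Literature.Analysis.FunctionSpaces Literature.Analysis.FunctionSpaces.Torus
open Literature.Analysis.FluidPDE Literature.Analysis.FluidPDE.Torus Literature.Analysis.FluidPDE.LatticeShear
open Summit.AnomalousDissipation.AnomalousDissipation.Theorems.SolenoidalFractalHomogenisation.PermissibleCarrier (period_pos)

variable {k₀ : ℕ}

/-- **Rescaling a periodic response**: for `c ≠ 0`, `t ↦ (c⁻¹ • 1) ∘ N t ∘ (c • 1)` is again a periodic response (the system is `ℂ`-linear).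
[cite: SandersVerhulstMurdock2007, Lemma 5.2.7 (linear case)] -/
theorem isPeriodicResponseθ_smul_conj (W₁ : LatticeWord k₀) (𝔸 : Torus.Visc4 (Fin 3)) (G₀ : Matrix (Fin 3) (Fin 3) ℝ) (γ₁ : ℝ) (R : ℕ) (j : Fin k₀)
    {N : ℝ → (EuclideanSpace ℂ (Fin 3) →L[ℝ] Space R)} (hN : IsPeriodicResponseθ W₁ 𝔸 G₀ γ₁ R j N) {c : ℂ} (hc : c ≠ 0) :
    IsPeriodicResponseθ W₁ 𝔸 G₀ γ₁ R j fun t =>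
      ((c⁻¹ • ContinuousLinearMap.id ℂ (Space R)).restrictScalars ℝ).comp
        ((N t).comp ((c • ContinuousLinearMap.id ℂ (EuclideanSpace ℂ (Fin 3))).restrictScalars ℝ)) := by
  obtain ⟨hcN, hdN, hpN⟩ := hN
  set A : Space R →L[ℝ] Space R := (c⁻¹ • ContinuousLinearMap.id ℂ (Space R)).restrictScalars ℝ with hA
  set B : EuclideanSpace ℂ (Fin 3) →L[ℝ] EuclideanSpace ℂ (Fin 3) :=
    (c • ContinuousLinearMap.id ℂ (EuclideanSpace ℂ (Fin 3))).restrictScalars ℝ with hB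
  have hAv : ∀ w : Space R, A w = c⁻¹ • w := fun w => rfl
  have hBv : ∀ v : EuclideanSpace ℂ (Fin 3), B v = c • v := fun v => rfl
  refine ⟨?_, fun t ht => ?_, by simp only [hpN]⟩
  · rw [continuousOn_clm_apply]
    intro v
    have h := (hcN.clm_apply (continuousOn_const (c := B v))).const_smul c⁻¹
    refine h.congr fun t _ => ?_
    simp only [ContinuousLinearMap.comp_apply, hAv, Pi.smul_apply]
  · have h := ((hasDerivAt_const t A).clm_comp ((hdN t ht).clm_comp (hasDerivAt_const t B)))
    simp only [ContinuousLinearMap.zero_comp, ContinuousLinearMap.comp_zero, zero_add, add_zero] at h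
    refine h.congr_deriv ?_
    refine ContinuousLinearMap.ext fun v => ?_
    simp only [ContinuousLinearMap.comp_apply, add_apply, ContinuousLinearMap.coe_restrictScalars', hAv, hBv,
      map_smul, smul_add, smul_smul, inv_mul_cancel₀ hc, one_smul]

/-- **The periodic response is `ℂ`-homogeneous**: `response … t (c • v) = c • response … t v` for `t ∈ [0,P]`.
[cite: SandersVerhulstMurdock2007, Lemma 5.2.7 (linear case)] -/
theorem responseθ_map_smul (W₁ : LatticeWord k₀) {𝔸 : Torus.Visc4 (Fin 3)} {lo' hi' : ℝ} (h𝔸 : Torus.NearIso 𝔸 lo' hi') (hlo' : 0 < lo')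
    (G₀ : Matrix (Fin 3) (Fin 3) ℝ) {c : ℝ} (hc : 0 < c) (hG : ∀ k : Fin 3 → ℤ, c * freqNormSq k ≤ ∑ a, twistFreq G₀ k a ^ 2)
    {γ₁ : ℝ} (hγ₁ : 0 < γ₁) (R : ℕ) (j : Fin k₀) (a : ℂ) (v : EuclideanSpace ℂ (Fin 3)) {t : ℝ} (ht : t ∈ Icc 0 W₁.period) :
    responseθ W₁ 𝔸 G₀ γ₁ R j t (a • v) = a • responseθ W₁ 𝔸 G₀ γ₁ R j t v := by
  by_cases hc' : a = 0
  · simp [hc']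
  have hN := isPeriodicResponseθ_responseθ_of_nearIso W₁ h𝔸 hlo' G₀ hc hG hγ₁ R j
  have hNc := isPeriodicResponseθ_smul_conj W₁ 𝔸 G₀ γ₁ R j hN hc'
  have heq := isPeriodicResponseθ_unique W₁ h𝔸 hlo' G₀ hc hG hγ₁ hNc hN t ht
  have h := congrArg (fun L : EuclideanSpace ℂ (Fin 3) →L[ℝ] Space R => a • L v) heq
  simp only [ContinuousLinearMap.comp_apply, ContinuousLinearMap.coe_restrictScalars', smul_apply,
    ContinuousLinearMap.id_apply, smul_smul, mul_inv_cancel₀ hc', one_smul] at h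
  exact h

/-- **The period-mean feedback matrices are `ℂ`-linear**: `M_{jj'} (c • v) = c • M_{jj'} v`. [cite: MajdaKramer1999, §2.2.1.3 (55)] -/
theorem meanFeedbackθ_map_smul (W₁ : LatticeWord k₀) {𝔸 : Torus.Visc4 (Fin 3)} {lo' hi' : ℝ} (h𝔸 : Torus.NearIso 𝔸 lo' hi') (hlo' : 0 < lo')
    (G₀ : Matrix (Fin 3) (Fin 3) ℝ) {c : ℝ} (hc : 0 < c) (hG : ∀ k : Fin 3 → ℤ, c * freqNormSq k ≤ ∑ a, twistFreq G₀ k a ^ 2)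
    {γ₁ : ℝ} (hγ₁ : 0 < γ₁) (R : ℕ) (j j' : Fin k₀) (a : ℂ) (v : EuclideanSpace ℂ (Fin 3)) :
    meanFeedbackθ W₁ 𝔸 G₀ γ₁ R j j' (a • v) = a • meanFeedbackθ W₁ 𝔸 G₀ γ₁ R j j' v := by
  have hP : 0 < W₁.period := period_pos W₁
  have hN := isPeriodicResponseθ_responseθ_of_nearIso W₁ h𝔸 hlo' G₀ hc hG hγ₁ R j'
  -- the integrand is continuous on `[0,P]`, hence integrable
  have hcont : ContinuousOn (fun t => ((feedback W₁ R j t).restrictScalars ℝ).comp (responseθ W₁ 𝔸 G₀ γ₁ R j' t)) (Icc 0 W₁.period) := by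
    rw [continuousOn_clm_apply]
    intro w
    have h1 : ContinuousOn (fun t => responseθ W₁ 𝔸 G₀ γ₁ R j' t w) (Icc 0 W₁.period) := hN.1.clm_apply continuousOn_const
    have h2 : Continuous (fun t => (feedback W₁ R j t).restrictScalars ℝ) := by
      rw [continuous_clm_apply]
      intro w
      exact ((continuous_clm_apply.1 (continuous_feedback W₁ R j)) w).congr fun t => rfl
    exact (h2.continuousOn.clm_apply h1).congr fun t _ => rfl
  have hint : IntegrableOn (fun t => ((feedback W₁ R j t).restrictScalars ℝ).comp (responseθ W₁ 𝔸 G₀ γ₁ R j' t)) (Ioc 0 W₁.period) volume :=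
    (hcont.integrableOn_compact isCompact_Icc).mono_set Ioc_subset_Icc_self
  have hI : ∫ t in Ioc 0 W₁.period, (((feedback W₁ R j t).restrictScalars ℝ).comp (responseθ W₁ 𝔸 G₀ γ₁ R j' t)) (a • v) =
      ∫ t in Ioc 0 W₁.period, a • ((((feedback W₁ R j t).restrictScalars ℝ).comp (responseθ W₁ 𝔸 G₀ γ₁ R j' t)) v) := by
    refine setIntegral_congr_fun measurableSet_Ioc fun t ht => ?_
    simp only [ContinuousLinearMap.comp_apply, ContinuousLinearMap.coe_restrictScalars',
      responseθ_map_smul W₁ h𝔸 hlo' G₀ hc hG hγ₁ R j' a v (Ioc_subset_Icc_self ht), map_smul]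
  rw [meanFeedbackθ, smul_apply, smul_apply, intervalIntegral.integral_of_le hP.le,
    ContinuousLinearMap.integral_apply hint, ContinuousLinearMap.integral_apply hint, hI, integral_smul, smul_comm]

end Summit.AnomalousDissipation.AnomalousDissipation.Theorems.SolenoidalFractalHomogenisation.LagrangianStep.Sideband

end
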